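import Mathlib
import HarnessLib
import Summits.AtomisticToContinuum.BoseEinsteinCondensation.Theses.BECThomsonPrinciple
import Summits.AtomisticToContinuum.BoseEinsteinCondensation.Theorems.GaussianDominationCan.Negative.CruxForms
import Summits.AtomisticToContinuum.BoseEinsteinCondensation.Theorems.GaussianDominationCan.Negative.LoadBearing
import Summits.AtomisticToContinuum.BoseEinsteinCondensation.Theorems.GaussianDominationCan.Negative.FreeConstant

/-!
# Line `raman-chord-regimes` for crux `BECThomsonPrinciple.GaussianDominationCan` (stmt-AtomisticToContinuum-9479)

Crux-plan skeleton (planner `cruxplan-stmt-AtomisticToContinuum-9479-raman-chord-regimes`, round 1).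
Idea card: `Cruxes/GaussianDominationCan/Ideas/raman-chord-regimes.md`; line card: `Lines/raman-chord-regimes.md`.

The crux is a CHORD inequality for every source strength `s ≥ 0`:
`E₀(w) + 2s|⟨Φ, Λ_k†Φ⟩| ≤ E_w(Φ) + C s² L²/‖n‖²` (`GDIneq w m L n C s Φ`, the crux's body in the
disprover's landed vocabulary `Negative.CruxForms`; the crux is `∀ v M, ∃ ρ₀ C N₀, GDCanWith …` by
`gaussianDominationCan_iff`).  The line splits the half-line `s ≥ 0` into three source-strength regimes,
for every bounded truncation `v_h = min(v, h)` of the potential, with `h`-UNIFORM constants, and passes to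
`v` by monotone convergence of the truncated ground-state energies:

* R3 (free anchor, PROVED here from `stub_freeChord`): `s² ≥ k̃² E₀(w)`, `k̃ = 2π‖n‖/L` — the free
  completing-the-square `T − s(Λ+Λ†) ≥ −s²/k²` plus `V ≥ 0` gives the chord with constant `1/(2π²)` for
  EVERY potential `w ≥ 0` (`anchorChord`).
* R2 (healing → anchor, `stub_healingChord`): `K k̃² ρ ∫v_h ≤ s² ≤ k̃² E₀(v_h)` — one-mode c-number
  substitution of the mode `k` (LSY 2005) + coherent stiffness of mode `k` (card freeze-one-mode-goldstone-gap
  K1) + canonical (fixed-`N`) Berezin–Lieb bookkeeping (K2); the LNSS phase operators `a₀ n̂₀^{-1/2}` stay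
  quantum (norm ≤ 1); the additive price `O(ρ ∫v_h)` of the substitution is affordable exactly when
  `s² ≥ K k̃² ρ ∫v_h`, for every `K > 0` at the cost `C(K) ~ (2 + c/K)/(4π²)`.
* R1 (quantum core, `stub_coreChord`, HARDEST): `s² ≤ K k̃² ρ ∫v_h` (and below the anchor) for SOME
  `K > 0` of the prover's choice — the chord for mesoscopic coherent displacements
  `|z|² ≲ K (∫v/8πa)(kξ)⁻²` of mode `k` (triage r1-1 sharpening), i.e. the crux's genuinely quantum
  content, handed to the curvature engine of whichever line the lead picks (flows / monotone path / Ward).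
* Truncation (`stub_truncatedEnergy`): `sup_{h>0} E₀(min(v,h)) = E₀(v)` at fixed `N, L` (Simon's
  monotone convergence for closed forms + Rellich on the torus; hard cores included), so that
  `h`-uniform chords for the truncations are chords for `v` (`gdIneq_of_trunc`, proved here).

Composition: `gdCan_of_stubs : ⟨freeChord⟩ → ⟨truncatedEnergy⟩ → ⟨coreChord⟩ → ⟨healingChord⟩ → (crux in
`GDCanWith` form)` is kernel-checked below with explicit hypotheses (constants: `ρ₀ = min`,
`C = max(C₁, C₂, 1/(2π²))`, `N₀ = max`; regimes by `le_total` on `s²`), and the skeleton theorem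
`GaussianDominationCan_of : GaussianDominationCan` applies it to the four stubs (sole theorem concluding
the route decl by name).

HONEST SCOPE.  For integrable `v` (`∫ v < ∞`, all bounded `v`) the split has content: R2 ∪ R3 dispose
of every macroscopic displacement of mode `k` and R1 is a strict sub-regime.  For `∫ v = ∞` (hard cores)
`∫ v_h → ∞`, R2's window is empty for large `h` and R1 then asks for the whole sub-anchor chord of the
tall truncations uniformly in `h`: this line has NO separate hard-core lever (card: "flagged, not
hidden"); hard cores ride on R1's engine + truncation + the anchor.

DISPROOF USED (landed `Theorems/GaussianDominationCan/Negative/*`; the evidence file Disproof.lean itself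
is not mounted in planner jails): `gaussianDominationCan_false_without_n_ne_zero` — honoured: every stub
carries `n ≠ 0` (the free chord is false at `n = 0`); `gaussianDominationCan_false_without_symm` — honoured:
all stubs quantify over `PeriodicTrialState` (Bose-symmetric; the `2(m+1)` calibration of the source is
used in `stub_freeChord`); `free_const_ge` / `not_gaussianDominationCan_sharp` — consistent: the anchor
constant of `stub_freeChord` is exactly the forced minimum `1/(4π²)` (see the `example` after the stub),
R3's is `1/(2π²)`; `gaussianDominationCan_iff_noN₀` — `N₀` kept for convenience only;
`gaussianDominationCan_iff_bare` — guards carried verbatim.  No stub is an instance refuted by a landed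
Negative lemma (the only `¬`-theorems delete `n ≠ 0` / Bose symmetry or demand `C < 1/(4π²)`).
-/

noncomputable section

namespace Summit.AtomisticToContinuum.BoseEinsteinCondensation.Cruxes.GaussianDominationCan.RamanChordRegimes

open MeasureTheory
open scoped ENNReal NNReal
open Literature.MathematicalPhysics.QuantumManyBody.BoseGas
open Summit.AtomisticToContinuum.BoseEinsteinCondensation.Theorems.GaussianDominationCan.Negative

/-! ## Registered stubs -/

/-- **stub_freeChord** (R3's anchor; = `FreeGDChord` of SketchIdeator2 / `FreeAnchor` of the
truncation-flow card — shared with the monotone-path line).  For the FREE gas the crux's chord holds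
with the sharp constant `1/(4π²)` for every `N ≥ 1`, `L > 0`, `n ≠ 0`, `s ≥ 0` and every periodic trial
state, with no density window: `E₀(0) = 0`, `T ≥ |k|² n_k = |k|² Λ_k†Λ_k` (`Λ_k†Λ_k = n_k` exactly since
`a₀ n̂₀⁻¹ a₀† = 1`) and `|k|²Λ†Λ − s(Λ+Λ†) = |k|²(Λ − s/|k|²)†(Λ − s/|k|²) − s²/|k|² ≥ −s²/|k|²`; the typed
penalty uses the sup norm `‖n‖∞ ≤ |n|₂`, which only weakens the claim.  Why plausibly true: operator
identity (refuter hand check on the item; Bogoliubov/one-particle case `gdsq_one_particle` proved by the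
disprover, evidence Disproof.lean §7); `free_const_ge` shows the constant cannot be lowered.  Size M–L in
Lean (Parseval + gradient Parseval on the cell for the crux's `foldr` projections `Q_S`, `Θ`; blueprint
steps P1–P3 landed in `Negative.Structure{,II}`).  Leans on: `GDIneq`, `sourceIntegral`, `cellAvg_*`,
`modeProj_*`, `integral_conj_mul_cellAvg`. -/
theorem stub_freeChord :
    ∀ m : ℕ, ∀ L : ℝ, 0 < L → ∀ n : Fin 3 → ℤ, n ≠ 0 → ∀ s : ℝ, 0 ≤ s →
      ∀ Φ : PeriodicTrialState (m + 1) L, GDIneq 0 m L n (1 / (4 * Real.pi ^ 2)) s Φ := by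
  sorry

/-- Cross-check against the landed Negative lemmas: `stub_freeChord` is the free-gas crux instance
`GDCanWith ρ₀ (1/(4π²)) 0 0 M` for every `ρ₀, M` — exactly the constant `free_const_ge` proves to be
forced (`C ≥ 1/(4π²)`), so the stub is tight, not refuted (`not_gaussianDominationCan_sharp` refutes only
`C < 1/(4π²)`). -/
example (ρ₀ M : ℝ) : GDCanWith ρ₀ (1 / (4 * Real.pi ^ 2)) 0 0 M :=
  fun m _ L hL _ n hn _ s hs Φ => stub_freeChord m L hL n hn s hs Φ

/-- **stub_truncatedEnergy** (= `TruncatedEnergyConvergence` of the truncation-flow card — shared).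
At fixed particle number and side `L > 0`, the ground-state energies of the bounded truncations
`min(v, h)` increase to the ground-state energy of `v` as `h → ∞` (as a `sup` in `ℝ≥0∞`; hard cores and
the jammed case `E₀(v) = ⊤` included).  Why plausibly true: monotone convergence of densely defined closed
quadratic forms (Kato VIII §3 / Simon 1978, doi:10.1016/0022-1236(78)90094-0) + compactness of the
resolvent on the torus (Rellich) give convergence of the bottom of the spectrum; the limit form domain
`{Ψ ∈ H¹ : Ψ = 0 a.e. on the core set}` equals the closure of the crux's `C¹` class vanishing on the cores
(the core set is a fat semi-algebraic set whose singular strata have codimension 2, hence zero capacity).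
Size L in Lean (no form-convergence library in Mathlib).  Leans on: `periodicGroundStateEnergy`,
`periodicEnergy`, `PeriodicTrialState`. -/
theorem stub_truncatedEnergy :
    ∀ v : ℝ → ℝ≥0∞, IsRepulsiveFiniteRange v → ∀ N : ℕ, ∀ L : ℝ, 0 < L →
      (⨆ (h : ℝ) (_ : 0 < h),
          periodicGroundStateEnergy (fun r => min (v r) (ENNReal.ofReal h)) N L) =
        periodicGroundStateEnergy v N L := by
  sorry

/-- **stub_coreChord** (R1, the quantum core — HARDEST; the crux's residual handed to a curvature
engine).  For every admissible `v` and window `M` there are `K > 0` (the prover's choice, possibly small)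
and `ρ₀, C, N₀` such that for EVERY truncation height `h > 0`, inside the density window, the chord for
`v_h = min(v,h)` holds with constant `C` for all source strengths with
`s² ≤ K k̃² ρ ∫v_h` (`k̃ = 2π‖n‖/L`, `ρ = N/L³`, `∫v_h = ∫_{ℝ³} min(v(|x|),h) dx`) that are also below the
free anchor `s² ≤ k̃² E₀(v_h)` (above it `anchorChord` applies).  In this regime the source has built at
most a mesoscopic coherent amplitude in mode `k`, `|z|² ≲ K(∫v/8πa)(kξ)⁻²`, `N`-independent (triage
r1-1: NOT "within the zero-point width", which is exceeded at the infrared end).  Why it might fail / why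
it is the core: by the convexity lemma of the card a bound on the curvature at `s = 0` alone does not give
it — one needs Gaussian domination uniformly along the weakly dressed family `H − s'(Λ^θ+h.c.)`,
`s' ≤ s`, whose ground state is not positive (flows see only `s' = 0`); at `k → 2π/L` its content is the
`T = 0` phase stiffness `ρ_s ≳ ρ/C` (Josephson), open for every `v ≠ 0`.  For `∫v = ∞` (hard cores) the
first bound exceeds the anchor for large `h` and this stub is then the whole sub-anchor chord of the tall
truncations, uniformly in `h` (no hard-core lever on this line — card: flagged).  Not a restatement of the
crux: restricted regime, `∃ K`, and typed on bounded potentials (where `Ψ₀ > 0` and Thomson flows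
exist).  Size: open-problem.  Leans on: `GDIneq`, `InWindow`; evidence ED j006865 (chord constant
`1.000` at `U = 0`, decreasing in `U`). -/
theorem stub_coreChord :
    ∀ v : ℝ → ℝ≥0∞, IsRepulsiveFiniteRange v → ∀ M : ℝ, 0 < M →
      ∃ K ρ₀ C : ℝ, 0 < K ∧ 0 < ρ₀ ∧ 0 < C ∧ ∃ N₀ : ℕ, ∀ h : ℝ, 0 < h →
        ∀ m : ℕ, N₀ ≤ m + 1 → ∀ L : ℝ, 0 < L → ((m + 1 : ℕ) : ℝ) ≤ ρ₀ * L ^ 3 →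
        ∀ n : Fin 3 → ℤ, n ≠ 0 → InWindow M m L n → ∀ s : ℝ, 0 ≤ s →
          s ^ 2 ≤ K * ((2 * Real.pi * ‖(fun j => (n j : ℝ))‖ / L) ^ 2 *
            (((m + 1 : ℕ) : ℝ) / L ^ 3) *
              (∫⁻ x : Space, min (v ‖x‖) (ENNReal.ofReal h)).toReal) →
          s ^ 2 ≤ (2 * Real.pi * ‖(fun j => (n j : ℝ))‖ / L) ^ 2 *
            (periodicGroundStateEnergy (fun r => min (v r) (ENNReal.ofReal h)) (m + 1) L).toReal →
          ∀ Φ : PeriodicTrialState (m + 1) L,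
            GDIneq (fun r => min (v r) (ENNReal.ofReal h)) m L n C s Φ := by
  sorry

/-- **stub_healingChord** (R2, healing → anchor; the card's `ChordAboveHealing`, typed uniformly over
truncations and for every `K`).  For every admissible `v`, window `M` and `K > 0` there are `ρ₀, C, N₀`
such that for every `h > 0`, inside the density window, the chord for `v_h = min(v,h)` holds with
constant `C` on `K k̃² ρ ∫v_h ≤ s² ≤ k̃² E₀(v_h)`.  Mechanism: substitute the ONE mode `k` by a c-number
`z` (Lieb–Seiringer–Yngvason 2005, arXiv:math-ph/0412023 = doi:10.1103/PhysRevLett.94.080401: upper =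
lower symbol for the source, which is linear in `a_k, a_k†` ⊗ a bounded function of mode `0` since
`‖a₀ n̂₀^{-1/2}‖ ≤ 1`; additive error `B = O(ρ ∫v_h)`), then
`H(s) ≥ G_k(z) − 2s|z| − B ≥ E₀ − B' − max_z (2s|z| − κ|z|²) = E₀ − B' − s²/κ` given the COHERENT
STIFFNESS `G_k(z) ≥ G_k(0) + κ|z|² − B₀`, `κ ≥ ½|k|²`, `B₀ = O(ρ∫v_h)` (card freeze-one-mode-goldstone-gap
K1) and canonical Berezin–Lieb bookkeeping with a number penalty (K2, triage r1-3); the total additive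
price `B' = O(ρ∫v_h)` is `≤ (c/K)·s²/k̃²` on the window, whence `C(K) ≈ (2 + c/K)/(4π²)`, uniformly in
`h` (everything is monotone in `∫v_h ≤ ∫v`; for hard cores the window is empty once
`K ρ ∫v_h > E₀(v_h)`).  Why it might fail: K1 in the infrared is a `T = 0` phase-stiffness statement
(`κ → 2ρ_s|k|²/n₀`, Bogoliubov `κ = |k|²(|k|²+2μ)/(|k|²+μ) ∈ [|k|², 2|k|²]` leaves a factor-2 margin but any
proof must resolve the bath's response at wavelength `1/k` to relative precision `k²/μ`, triage r1-2);
K2 costs `λ·O(N' + |z|²)` symbol errors that must fit under `C s²/k̃²`.  Size: L / open-problem (K1).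
Leans on: `GDIneq`, `InWindow`; facts to vendor: LSY 2005 one-mode bounds, Berezin–Lieb
(doi:10.1007/BF01646493); evidence j006865 (`⟨V⟩` raised by the source; Josephson factor ∈ [0.87,1]). -/
theorem stub_healingChord :
    ∀ v : ℝ → ℝ≥0∞, IsRepulsiveFiniteRange v → ∀ M : ℝ, 0 < M → ∀ K : ℝ, 0 < K →
      ∃ ρ₀ C : ℝ, 0 < ρ₀ ∧ 0 < C ∧ ∃ N₀ : ℕ, ∀ h : ℝ, 0 < h →
        ∀ m : ℕ, N₀ ≤ m + 1 → ∀ L : ℝ, 0 < L → ((m + 1 : ℕ) : ℝ) ≤ ρ₀ * L ^ 3 →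
        ∀ n : Fin 3 → ℤ, n ≠ 0 → InWindow M m L n → ∀ s : ℝ, 0 ≤ s →
          K * ((2 * Real.pi * ‖(fun j => (n j : ℝ))‖ / L) ^ 2 *
            (((m + 1 : ℕ) : ℝ) / L ^ 3) *
              (∫⁻ x : Space, min (v ‖x‖) (ENNReal.ofReal h)).toReal) ≤ s ^ 2 →
          s ^ 2 ≤ (2 * Real.pi * ‖(fun j => (n j : ℝ))‖ / L) ^ 2 *
            (periodicGroundStateEnergy (fun r => min (v r) (ENNReal.ofReal h)) (m + 1) L).toReal →
          ∀ Φ : PeriodicTrialState (m + 1) L,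
            GDIneq (fun r => min (v r) (ENNReal.ofReal h)) m L n C s Φ := by
  sorry

/-! ## Glue (proved): monotonicity in the potential, the free anchor R3, truncation, regimes -/

/-- `v ↦ v^per` is monotone. [folklore] -/
theorem periodizedPotential_mono {w₁ w₂ : ℝ → ℝ≥0∞} (hw : ∀ r, w₁ r ≤ w₂ r) (L : ℝ) (x : Space) :
    periodizedPotential w₁ L x ≤ periodizedPotential w₂ L x := by
  unfold periodizedPotential
  exact ENNReal.tsum_le_tsum fun _ => hw _

/-- `v ↦ ∑_{i<j} v^per(xᵢ - xⱼ)` is monotone. [folklore] -/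
theorem periodicInteraction_mono {N : ℕ} {w₁ w₂ : ℝ → ℝ≥0∞} (hw : ∀ r, w₁ r ≤ w₂ r) (L : ℝ)
    (X : Config N) : periodicInteraction w₁ L X ≤ periodicInteraction w₂ L X := by
  unfold periodicInteraction
  exact Finset.sum_le_sum fun i _ => Finset.sum_le_sum fun j _ => periodizedPotential_mono hw L _

/-- `v ↦ E_v(Ψ)` is monotone (in particular `E_{min(v,h)}(Ψ) ≤ E_v(Ψ)` and `E_0(Ψ) ≤ E_v(Ψ)`).
[folklore] -/
theorem periodicEnergy_mono {N : ℕ} {L : ℝ} {w₁ w₂ : ℝ → ℝ≥0∞} (hw : ∀ r, w₁ r ≤ w₂ r)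
    (Ψ : PeriodicTrialState N L) : periodicEnergy w₁ Ψ ≤ periodicEnergy w₂ Ψ := by
  unfold periodicEnergy
  exact lintegral_mono fun X =>
    add_le_add le_rfl (mul_le_mul' (periodicInteraction_mono hw L X) le_rfl)

/-- **R3, the free anchor** (`LargeSAnchor` of the card, derived from `stub_freeChord` and `V ≥ 0`):
for EVERY potential `w ≥ 0` the chord holds with constant `1/(2π²)` once `s² ≥ k̃² E₀(w)`,
`k̃ = 2π‖n‖/L`: `E₀(w) ≤ s²L²/(4π²‖n‖²)` pays for itself and the free chord pays the source.  With
Dyson's bound (`LSSY2005_upperBound_periodic_holds`) the threshold is `s ≳ k̃ √(4πaρN)`.  Usable by every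
line as a support lemma (triage r1-1/r1-2). -/
theorem anchorChord
    (hfree : ∀ m : ℕ, ∀ L : ℝ, 0 < L → ∀ n : Fin 3 → ℤ, n ≠ 0 → ∀ s : ℝ, 0 ≤ s →
      ∀ Φ : PeriodicTrialState (m + 1) L, GDIneq 0 m L n (1 / (4 * Real.pi ^ 2)) s Φ)
    (w : ℝ → ℝ≥0∞) (m : ℕ) {L : ℝ} (hL : 0 < L) {n : Fin 3 → ℤ} (hn : n ≠ 0) {s : ℝ}
    (hs : 0 ≤ s)
    (hs2 : (2 * Real.pi * ‖(fun j => (n j : ℝ))‖ / L) ^ 2 *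
        (periodicGroundStateEnergy w (m + 1) L).toReal ≤ s ^ 2)
    (Φ : PeriodicTrialState (m + 1) L) : GDIneq w m L n (1 / (2 * Real.pi ^ 2)) s Φ := by
  unfold GDIneq
  by_cases htop : periodicGroundStateEnergy w (m + 1) L = ⊤
  · have hE : periodicEnergy w Φ = ⊤ :=
      eq_top_iff.mpr (htop ▸ periodicGroundStateEnergy_le w Φ)
    rw [hE, top_add]
    exact le_top
  have hfreeΦ := hfree m L hL n hn s hs Φ
  unfold GDIneq at hfreeΦ
  have hA : ENNReal.ofReal (s * (2 * (m + 1) * ‖sourceIntegral m L n Φ.ψ‖)) ≤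
      periodicEnergy 0 Φ +
        ENNReal.ofReal (1 / (4 * Real.pi ^ 2) * s ^ 2 * L ^ 2 / ‖(fun j => (n j : ℝ))‖ ^ 2) :=
    le_trans le_add_self hfreeΦ
  have hE0w : periodicEnergy 0 Φ ≤ periodicEnergy w Φ := periodicEnergy_mono (fun r => bot_le) Φ
  have hnorm : 0 < ‖(fun j => (n j : ℝ))‖ := lt_of_lt_of_le one_pos (one_le_norm_intVec hn)
  have hpen : 0 ≤ 1 / (4 * Real.pi ^ 2) * s ^ 2 * L ^ 2 / ‖(fun j => (n j : ℝ))‖ ^ 2 := by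
    positivity
  have hE0 : periodicGroundStateEnergy w (m + 1) L ≤
      ENNReal.ofReal (1 / (4 * Real.pi ^ 2) * s ^ 2 * L ^ 2 / ‖(fun j => (n j : ℝ))‖ ^ 2) := by
    rw [← ENNReal.ofReal_toReal htop]
    apply ENNReal.ofReal_le_ofReal
    set E : ℝ := (periodicGroundStateEnergy w (m + 1) L).toReal with hEdef
    have hk : (2 * Real.pi * ‖(fun j => (n j : ℝ))‖ / L) ^ 2 =
        4 * Real.pi ^ 2 * ‖(fun j => (n j : ℝ))‖ ^ 2 / L ^ 2 := by ring
    rw [hk, div_mul_eq_mul_div, div_le_iff₀ (by positivity)] at hs2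
    rw [le_div_iff₀ (by positivity)]
    have h4 : (0 : ℝ) < 4 * Real.pi ^ 2 := by positivity
    calc E * ‖(fun j => (n j : ℝ))‖ ^ 2
        = (4 * Real.pi ^ 2 * ‖(fun j => (n j : ℝ))‖ ^ 2 * E) / (4 * Real.pi ^ 2) := by
          rw [eq_div_iff h4.ne']
          ring
      _ ≤ (s ^ 2 * L ^ 2) / (4 * Real.pi ^ 2) := div_le_div_of_nonneg_right hs2 h4.le
      _ = 1 / (4 * Real.pi ^ 2) * s ^ 2 * L ^ 2 := by ring
  calc periodicGroundStateEnergy w (m + 1) L +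
        ENNReal.ofReal (s * (2 * (m + 1) * ‖sourceIntegral m L n Φ.ψ‖))
      ≤ ENNReal.ofReal (1 / (4 * Real.pi ^ 2) * s ^ 2 * L ^ 2 / ‖(fun j => (n j : ℝ))‖ ^ 2) +
          (periodicEnergy 0 Φ +
            ENNReal.ofReal (1 / (4 * Real.pi ^ 2) * s ^ 2 * L ^ 2 / ‖(fun j => (n j : ℝ))‖ ^ 2)) :=
        add_le_add hE0 hA
    _ ≤ ENNReal.ofReal (1 / (4 * Real.pi ^ 2) * s ^ 2 * L ^ 2 / ‖(fun j => (n j : ℝ))‖ ^ 2) +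
          (periodicEnergy w Φ +
            ENNReal.ofReal (1 / (4 * Real.pi ^ 2) * s ^ 2 * L ^ 2 / ‖(fun j => (n j : ℝ))‖ ^ 2)) :=
        add_le_add le_rfl (add_le_add hE0w le_rfl)
    _ = periodicEnergy w Φ +
          (ENNReal.ofReal (1 / (4 * Real.pi ^ 2) * s ^ 2 * L ^ 2 / ‖(fun j => (n j : ℝ))‖ ^ 2) +
            ENNReal.ofReal (1 / (4 * Real.pi ^ 2) * s ^ 2 * L ^ 2 / ‖(fun j => (n j : ℝ))‖ ^ 2)) := by
        rw [add_left_comm]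
    _ = periodicEnergy w Φ +
          ENNReal.ofReal (1 / (2 * Real.pi ^ 2) * s ^ 2 * L ^ 2 / ‖(fun j => (n j : ℝ))‖ ^ 2) := by
        rw [← ENNReal.ofReal_add hpen hpen]
        congr 2
        ring

/-- **Truncation glue**: a chord valid for every bounded truncation `min(v,h)`, `h > 0`, with
`h`-independent data is a chord for `v` — by `E_{min(v,h)}(Φ) ≤ E_v(Φ)` and
`sup_h E₀(min(v,h)) = E₀(v)` (`stub_truncatedEnergy`).  This is `TruncationReduction` of the
truncation-flow card at the level of one inequality. -/
theorem gdIneq_of_trunc {v : ℝ → ℝ≥0∞} {m : ℕ} {L : ℝ} {n : Fin 3 → ℤ} {C s : ℝ}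
    {Φ : PeriodicTrialState (m + 1) L}
    (hconv : (⨆ (h : ℝ) (_ : 0 < h),
        periodicGroundStateEnergy (fun r => min (v r) (ENNReal.ofReal h)) (m + 1) L) =
      periodicGroundStateEnergy v (m + 1) L)
    (hall : ∀ h : ℝ, 0 < h → GDIneq (fun r => min (v r) (ENNReal.ofReal h)) m L n C s Φ) :
    GDIneq v m L n C s Φ := by
  unfold GDIneq at hall ⊢
  rw [← hconv, ENNReal.biSup_add' ⟨1, one_pos⟩]
  refine iSup₂_le fun h hh => (hall h hh).trans ?_
  exact add_le_add (periodicEnergy_mono (fun r => min_le_left _ _) Φ) le_rfl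

/-! ## The kernel-checked composition -/

/-- **Composition with explicit hypotheses** (reusable by other lines: feed it any proofs of the four
stub statements).  Given `v, M`: take `K, ρ₁, C₁, N₁` from the core statement, `ρ₂, C₂, N₂` from the
healing statement at that `K`; the crux's constants are `ρ₀ = min ρ₁ ρ₂`,
`C = max (max C₁ C₂) (1/(2π²))`, `N₀ = max N₁ N₂`.  For admissible `m, L, n`, `s ≥ 0`, `Φ` and every
`h > 0` the three regimes `s² ≤ K k̃²ρ∫v_h ∧ s² ≤ k̃²E₀(v_h)` (core), `K k̃²ρ∫v_h ≤ s² ≤ k̃²E₀(v_h)`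
(healing), `k̃²E₀(v_h) ≤ s²` (anchor, from the free chord) cover `s`, giving the chord for `min(v,h)`
with the common constant; truncation glue gives it for `v`.  The conclusion is the crux in the
disprover's `GDCanWith` form (`gaussianDominationCan_iff`), so that `GaussianDominationCan_of` below is
the ONLY theorem of this file concluding the route decl by name. -/
theorem gdCan_of_stubs :
    (∀ m : ℕ, ∀ L : ℝ, 0 < L → ∀ n : Fin 3 → ℤ, n ≠ 0 → ∀ s : ℝ, 0 ≤ s →
      ∀ Φ : PeriodicTrialState (m + 1) L, GDIneq 0 m L n (1 / (4 * Real.pi ^ 2)) s Φ) →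
    (∀ v : ℝ → ℝ≥0∞, IsRepulsiveFiniteRange v → ∀ N : ℕ, ∀ L : ℝ, 0 < L →
      (⨆ (h : ℝ) (_ : 0 < h),
          periodicGroundStateEnergy (fun r => min (v r) (ENNReal.ofReal h)) N L) =
        periodicGroundStateEnergy v N L) →
    (∀ v : ℝ → ℝ≥0∞, IsRepulsiveFiniteRange v → ∀ M : ℝ, 0 < M →
      ∃ K ρ₀ C : ℝ, 0 < K ∧ 0 < ρ₀ ∧ 0 < C ∧ ∃ N₀ : ℕ, ∀ h : ℝ, 0 < h →
        ∀ m : ℕ, N₀ ≤ m + 1 → ∀ L : ℝ, 0 < L → ((m + 1 : ℕ) : ℝ) ≤ ρ₀ * L ^ 3 →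
        ∀ n : Fin 3 → ℤ, n ≠ 0 → InWindow M m L n → ∀ s : ℝ, 0 ≤ s →
          s ^ 2 ≤ K * ((2 * Real.pi * ‖(fun j => (n j : ℝ))‖ / L) ^ 2 *
            (((m + 1 : ℕ) : ℝ) / L ^ 3) *
              (∫⁻ x : Space, min (v ‖x‖) (ENNReal.ofReal h)).toReal) →
          s ^ 2 ≤ (2 * Real.pi * ‖(fun j => (n j : ℝ))‖ / L) ^ 2 *
            (periodicGroundStateEnergy (fun r => min (v r) (ENNReal.ofReal h)) (m + 1) L).toReal →
          ∀ Φ : PeriodicTrialState (m + 1) L,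
            GDIneq (fun r => min (v r) (ENNReal.ofReal h)) m L n C s Φ) →
    (∀ v : ℝ → ℝ≥0∞, IsRepulsiveFiniteRange v → ∀ M : ℝ, 0 < M → ∀ K : ℝ, 0 < K →
      ∃ ρ₀ C : ℝ, 0 < ρ₀ ∧ 0 < C ∧ ∃ N₀ : ℕ, ∀ h : ℝ, 0 < h →
        ∀ m : ℕ, N₀ ≤ m + 1 → ∀ L : ℝ, 0 < L → ((m + 1 : ℕ) : ℝ) ≤ ρ₀ * L ^ 3 →
        ∀ n : Fin 3 → ℤ, n ≠ 0 → InWindow M m L n → ∀ s : ℝ, 0 ≤ s →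
          K * ((2 * Real.pi * ‖(fun j => (n j : ℝ))‖ / L) ^ 2 *
            (((m + 1 : ℕ) : ℝ) / L ^ 3) *
              (∫⁻ x : Space, min (v ‖x‖) (ENNReal.ofReal h)).toReal) ≤ s ^ 2 →
          s ^ 2 ≤ (2 * Real.pi * ‖(fun j => (n j : ℝ))‖ / L) ^ 2 *
            (periodicGroundStateEnergy (fun r => min (v r) (ENNReal.ofReal h)) (m + 1) L).toReal →
          ∀ Φ : PeriodicTrialState (m + 1) L,
            GDIneq (fun r => min (v r) (ENNReal.ofReal h)) m L n C s Φ) →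
    ∀ v : ℝ → ℝ≥0∞, IsRepulsiveFiniteRange v → ∀ M : ℝ, 0 < M →
      ∃ ρ₀ C : ℝ, 0 < ρ₀ ∧ 0 < C ∧ ∃ N₀ : ℕ, GDCanWith ρ₀ C N₀ v M := by
  intro h1 h2 h3 h4 v hv M hM
  obtain ⟨K, ρ₁, C₁, hK, hρ₁, hC₁, N₁, H1⟩ := h3 v hv M hM
  obtain ⟨ρ₂, C₂, hρ₂, hC₂, N₂, H2⟩ := h4 v hv M hM K hK
  refine ⟨min ρ₁ ρ₂, max (max C₁ C₂) (1 / (2 * Real.pi ^ 2)), lt_min hρ₁ hρ₂,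
    lt_max_of_lt_left (lt_max_of_lt_left hC₁), max N₁ N₂, ?_⟩
  intro m hm L hL hd n hn hw s hs Φ
  have hm₁ : N₁ ≤ m + 1 := le_trans (le_max_left _ _) hm
  have hm₂ : N₂ ≤ m + 1 := le_trans (le_max_right _ _) hm
  have hd₁ : ((m + 1 : ℕ) : ℝ) ≤ ρ₁ * L ^ 3 :=
    hd.trans (mul_le_mul_of_nonneg_right (min_le_left _ _) (by positivity))
  have hd₂ : ((m + 1 : ℕ) : ℝ) ≤ ρ₂ * L ^ 3 :=
    hd.trans (mul_le_mul_of_nonneg_right (min_le_right _ _) (by positivity))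
  refine gdIneq_of_trunc (h2 v hv (m + 1) L hL) fun h hh => ?_
  rcases le_total (s ^ 2)
      ((2 * Real.pi * ‖(fun j => (n j : ℝ))‖ / L) ^ 2 *
        (periodicGroundStateEnergy (fun r => min (v r) (ENNReal.ofReal h)) (m + 1) L).toReal)
    with hsA | hAs
  · rcases le_total (s ^ 2)
        (K * ((2 * Real.pi * ‖(fun j => (n j : ℝ))‖ / L) ^ 2 * (((m + 1 : ℕ) : ℝ) / L ^ 3) *
          (∫⁻ x : Space, min (v ‖x‖) (ENNReal.ofReal h)).toReal))
      with hsK | hKs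
    · exact (H1 h hh m hm₁ L hL hd₁ n hn hw s hs hsK hsA Φ).mono_C
        (le_trans (le_max_left _ _) (le_max_left _ _))
    · exact (H2 h hh m hm₂ L hL hd₂ n hn hw s hs hKs hsA Φ).mono_C
        (le_trans (le_max_right _ _) (le_max_left _ _))
  · exact (anchorChord h1 _ m hL hn hs hAs Φ).mono_C (le_max_right _ _)

/-- **The skeleton theorem** (A12): concludes the route decl `BECThomsonPrinciple.GaussianDominationCan`
BY NAME from the four registered stubs and nothing else (`sorry` only inside `stub_*`; this theorem's own
axioms are the stubs' `sorryAx` plus the standard three).  `stub_freeChord → stub_truncatedEnergy →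
stub_coreChord → stub_healingChord → GaussianDominationCan`. -/
theorem GaussianDominationCan_of :
    Summit.AtomisticToContinuum.BoseEinsteinCondensation.Theses.BECThomsonPrinciple.GaussianDominationCan :=
  gaussianDominationCan_iff.mpr
    (gdCan_of_stubs stub_freeChord stub_truncatedEnergy stub_coreChord stub_healingChord)

end Summit.AtomisticToContinuum.BoseEinsteinCondensation.Cruxes.GaussianDominationCan.RamanChordRegimes

end
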